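import Summits.NavierStokesRegularity.NavierStokesRegularity.Theses.AxisymmetricExtremality
import Literature.Analysis.FluidPDE.NSKatoToClayHolds
import Literature.Analysis.FluidPDE.MildSolutionsProofs
import Literature.Analysis.FunctionSpaces.FourierSobolevNormProofs
import Literature.Analysis.FunctionSpaces.FourierSobolevNormEmbeddingProofs
import Literature.Analysis.FluidPDE.CriticalSpaces
import Literature.Analysis.FluidPDE.VectorCalculus
import Mathlib.Analysis.Distribution.Sobolev

/-!
# Route AxisymmetricExtremality — crux `MinimalDatumPFold` (stmt-NavierStokesRegularity-15452), stub `stub_thresholdFinite_of_clayFailure`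

Registered stub of the line `registered` (`Cruxes/MinimalDatumPFold/Lines/birth.lean`, lead c1 reshape).
Target tree file: `Summits/NavierStokesRegularity/NavierStokesRegularity/Theorems/AxisymmetricExtremalityMinimalDatumPFoldThresholdFinite.lean`.

**Routine front end of `MinimalDatumPFold_of`.** If Clay (A) fails at viscosity `ν > 0` — some
smooth, divergence-free, rapidly decaying datum `v₀` has no jointly smooth bounded-energy global
solution — then the pure `Ḣ^{1/2}` Rusin–Šverák threshold `rusinSverakRhoMaxPure ν` is finite.

Proof. (a) `v₀` has no global Kato solution, since a global Kato solution of a Clay datum is a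
Clay solution (`clay_solution_of_hasGlobalKatoSolution_holds`). (b) The complexified datum
`complexify ∘ v₀` is a Schwartz map (`complexify` is a real linear isometry, so smoothness and the
decay of all derivatives transfer: `contDiff_complexify_comp_iff`,
`LinearIsometry.norm_iteratedFDeriv_comp_left`). (c) A Schwartz map lies in every Sobolev space
(Mathlib `SchwartzMap.memSobolev`), hence — by the bridge
`memSobolev_two_iff_eFourierSobolevNorm_lt_top_holds` and `H^s ⊆ Ḣ^s ∩ L²` for `s ≥ 0`
(`MemFourierSobolev.memHomSobolev_holds`) — in `Ḣ^{1/2} ∩ L²`. (d) So `v₀ ∈ L³`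
(`memLp_three_of_memHomSobolev_half`), it is weakly divergence free
(`VectorCalculus.IsDivFree.isWeaklyDivFree_holds`), and it is represented by the class
`HomSobolev.ofFun _ hmem ∈ Ḣ^{1/2}` (`HomSobolev.represents_ofFun_holds`), an element of a normed
group, of finite `‖·‖ₑ`. (e) If `rusinSverakRhoMaxPure ν = ⊤`, this class lies below the
threshold, so `v₀` has a global Kato solution
(`hasGlobalKatoSolution_of_lt_rusinSverakRhoMaxPure`) — contradicting (a).
-/

set_option linter.dupNamespace false

noncomputable section

open MeasureTheory Set Function Filter Topology
open Literature.Analysis.FluidPDE Literature.Analysis.FunctionSpaces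
open Literature.Analysis.FunctionSpaces.EuclideanSpace (complexify contDiff_complexify_comp_iff)
open scoped ENNReal NNReal SchwartzMap

namespace Summit.NavierStokesRegularity.NavierStokesRegularity.Theorems

/-- **Schwartz maps lie in `Ḣ^s ∩ L²` for `s ≥ 0`.** A Schwartz map `f : E → F` on a
finite-dimensional real inner product space with values in a complex Hilbert space satisfies
`MemHomSobolev s ⇑f` for every `s ≥ 0`: Mathlib's `SchwartzMap.memSobolev` puts (the tempered
distribution of) `f` in the Bessel-potential class `MemSobolev s 2`; by
`Lp.toTemperedDistribution_toLp_eq` this is the tempered distribution of the `L²` class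
`f.toLp 2`, so the bridge `memSobolev_two_iff_eFourierSobolevNorm_lt_top_holds` gives
`‖f‖_{H^s} < ∞`, i.e. `MemFourierSobolev s ⇑f` (the `L²` witness `f.memLp 2` defines the same
class `f.toLp 2`), and `H^s ⊆ Ḣ^s ∩ L²` for `s ≥ 0` (`MemFourierSobolev.memHomSobolev_holds`;
Bahouri–Chemin–Danchin 2011, §1.4.1). [folklore] -/
private theorem thresholdFinite_memHomSobolev_schwartz {E F : Type*} [NormedAddCommGroup E]
    [InnerProductSpace ℝ E] [FiniteDimensional ℝ E] [MeasurableSpace E] [BorelSpace E]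
    [NormedAddCommGroup F] [InnerProductSpace ℂ F] [CompleteSpace F] {s : ℝ} (hs : 0 ≤ s)
    (f : 𝓢(E, F)) : MemHomSobolev s (⇑f) := by
  -- the `L²` class of `f`, as a tempered distribution, is in the Bessel-potential class
  have hB : TemperedDistribution.MemSobolev s 2
      ((f.toLp 2 (volume : Measure E) : Lp F 2 (volume : Measure E)) : 𝓢'(E, F)) := by
    rw [Lp.toTemperedDistribution_toLp_eq]
    exact f.memSobolev
  -- the bridge (type arguments given explicitly, so that `volume` is matched syntactically)
  have h := memSobolev_two_iff_eFourierSobolevNorm_lt_top_holds (E := E) (F := F)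
  exact MemFourierSobolev.memHomSobolev_holds hs ⟨f.memLp 2 volume, (h s _).1 hB⟩

/-- **Clay failure forces a finite pure threshold** (routine front end of the crux
`MinimalDatumPFold`, stmt-NavierStokesRegularity-15452). For `ν > 0`: if some smooth,
divergence-free, rapidly decaying datum `v₀ : ℝ³ → ℝ³` admits no jointly smooth, bounded-energy
global solution `(u, p)` of the Navier–Stokes system, then `rusinSverakRhoMaxPure ν < ⊤`.
Proof sketch: `v₀` has no global Kato solution (`clay_solution_of_hasGlobalKatoSolution_holds`,
Kato 1984 Thm. 4 / Lemarié-Rieusset 2016 Prop. 12.3); `complexify ∘ v₀` is Schwartz, hence in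
`Ḣ^{1/2} ∩ L²` (`thresholdFinite_memHomSobolev_schwartz`), so `v₀ ∈ L³` is weakly divergence
free and represented by `HomSobolev.ofFun _ _ ∈ Ḣ^{1/2}` of finite norm; were the threshold `⊤`,
`hasGlobalKatoSolution_of_lt_rusinSverakRhoMaxPure` (Rusin–Šverák 2011, §1, unfolding of the
`sSup`) would produce a global Kato solution. [folklore] -/
theorem stub_thresholdFinite_of_clayFailure :
    ∀ ν : ℝ, 0 < ν → (∃ v₀ : EuclideanSpace ℝ (Fin 3) → EuclideanSpace ℝ (Fin 3), ContDiff ℝ (⊤ : ℕ∞) v₀ ∧ Literature.Analysis.FluidPDE.NSWave0.IsDivFree v₀ ∧ Literature.Analysis.FluidPDE.HasRapidSpatialDecay v₀ ∧ ¬ ∃ (u : ℝ → EuclideanSpace ℝ (Fin 3) → EuclideanSpace ℝ (Fin 3)) (p : ℝ → EuclideanSpace ℝ (Fin 3) → ℝ), Literature.Analysis.FluidPDE.IsSmoothOnHalfSpace u ∧ Literature.Analysis.FluidPDE.IsSmoothOnHalfSpace p ∧ Literature.Analysis.FluidPDE.IsNavierStokesSolution ν 0 v₀ u p ∧ Literature.Analysis.FluidPDE.HasBoundedEnergy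 u) → Literature.Analysis.FluidPDE.rusinSverakRhoMaxPure ν < ⊤ := by
  intro ν hν hfail
  obtain ⟨v₀, hsm, hdiv, hdec, hno⟩ := hfail
  -- (a) the datum has no global Kato solution
  have hK : ¬ HasGlobalKatoSolution ν v₀ := fun h =>
    hno (clay_solution_of_hasGlobalKatoSolution_holds ν hν v₀ hsm hdiv hdec h)
  -- (b) the complexified datum is a Schwartz map
  have hdecay : ∀ k n : ℕ, ∃ C : ℝ, ∀ x : EuclideanSpace ℝ (Fin 3),
      ‖x‖ ^ k * ‖iteratedFDeriv ℝ n (complexify ∘ v₀) x‖ ≤ C := by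
    intro k n
    obtain ⟨C, hC⟩ := hdec n k
    refine ⟨C, fun x => le_trans ?_ (hC x)⟩
    rw [(complexify (ι := Fin 3)).norm_iteratedFDeriv_comp_left hsm.contDiffAt
      (mod_cast le_top)]
    exact mul_le_mul_of_nonneg_right
      (pow_le_pow_left₀ (norm_nonneg _) (le_add_of_nonneg_left zero_le_one) k) (norm_nonneg _)
  -- (c) hence it lies in `Ḣ^{1/2} ∩ L²`
  have hmem : MemHomSobolev (1 / 2 : ℝ) (complexify ∘ v₀) :=
    thresholdFinite_memHomSobolev_schwartz (by norm_num)
      ⟨complexify ∘ v₀, contDiff_complexify_comp_iff.2 hsm, hdecay⟩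
  -- (d) the datum is `L³`, weakly divergence free, represented by a class in `Ḣ^{1/2}`
  have hu3 : MemLp v₀ 3 volume :=
    memLp_three_of_memHomSobolev_half eLpNorm_three_le_eHomSobolevSeminorm_half_holds hmem
  have hdiv' : VectorCalculus.IsDivFree v₀ := fun x => hdiv x
  have hwdiv : IsWeaklyDivFree v₀ :=
    VectorCalculus.IsDivFree.isWeaklyDivFree_holds hdiv' (hsm.of_le (mod_cast le_top))
  have hE : 0 < Module.finrank ℝ (EuclideanSpace ℝ (Fin 3)) := by
    rw [finrank_euclideanSpace_fin]
    norm_num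
  have hrep : (HomSobolev.ofFun (complexify ∘ v₀) hmem).Represents (complexify ∘ v₀) :=
    HomSobolev.represents_ofFun_holds hE (complexify ∘ v₀) hmem
  -- (e) a `⊤` threshold would give a global Kato solution
  by_contra htop
  rw [not_lt, top_le_iff] at htop
  have hlt : ‖HomSobolev.ofFun (complexify ∘ v₀) hmem‖ₑ < rusinSverakRhoMaxPure ν := by
    rw [htop]
    exact enorm_lt_top
  exact hK (hasGlobalKatoSolution_of_lt_rusinSverakRhoMaxPure hu3 hrep hwdiv hlt)

end Summit.NavierStokesRegularity.NavierStokesRegularity.Theorems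

end
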